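import Summits.MatrixMultiplication.MatrixMultiplication.Theorems.AbelianSTPPCensusShapeCertFinal
import Summits.MatrixMultiplication.MatrixMultiplication.Theorems.AbelianSTPPCensusVPHereditary

/-!
# vP certificate, delta Δ2: multiset mirrors of rules U11-G / U11-P, the bridge from `SieveAdmissibleVP`, and heredity

For crux `ShapeExclusionVP337` (route `AbelianSTPPCensusVP`) the lineage-B checker `ShapeCert` reasons about MULTISETS of member
shapes (`AdmM`, `GM`, `admM_GM`).  This file supplies the vP layer in the same idiom:
* `U11GFormBM` / `U11PFormBM` / `U11GM` / `U11PM` — the tree rules `U11GFormB` / `U11PFormB` / `U11G` / `U11P` (file `AbelianSTPPSieveVP`)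
  transcribed to a multiset of triples, with the letter rotations `rotA` `(a,b,c) ↦ (c,a,b)` and `rotC` `(a,b,c) ↦ (b,c,a)`;
  `AdmVPM M G := AdmM M G ∧ U11GM M G ∧ (M.Prime → U11PM M G)`;
* Boolean tests `u11GB` / `u11PB` (conjunction of three `decide`s — one per letter form, which keeps each synthesized
  `Decidable` instance under `synthInstance.maxSize`; kernel-evaluable) with `u11GB_iff` / `u11PB_iff` — the kill tests of CERTIFICATE-DESIGN §6 Δ3;
* exact bridges `pabM_GM`, `ubBM_GM`, `lBM_GM`, `u11GFormBM_GM : U11GFormBM M (GM a b c) ↔ U11GFormB M a b c`, `u11GM_GM`, `u11PM_GM`,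
  `admVPM_GM : 2 ≤ N → SieveAdmissibleVP M a b c → AdmVPM M (GM a b c)`;
* HEREDITY for realised sub-multisets: `u11GM_of_le` / `u11PM_of_le` / `admVP_u11_of_le` — every sub-multiset `L ≤ GM a b c` of a
  vP-admissible family satisfies `U11GM` (and `U11PM` at primes), via the injective choice of indices `ShapeCert.exists_emb_of_le` and the
  Fin-indexed heredity `VPRules.u11G_comp` / `u11P_comp` (p416879).  This is what lets the checker kill a NODE (partial family) by `u11GB = false`.
Cell mm-stpp, planner gen 7 (HOME/mm-stpp-plan/routeVP3-g7/CERTIFICATE-DESIGN.md §6 Δ2/Δ3).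
-/

set_option linter.dupNamespace false
set_option autoImplicit false

namespace Summit.MatrixMultiplication.MatrixMultiplication.Theorems.ShapeCert

open Multiset

/-! ### Multiset transcriptions of the rules -/

/-- `P_AB` of a shape multiset -/
def pabM (G : Multiset (ℕ × ℕ × ℕ)) : ℕ := (G.map pab).sum
/-- `P_BC` of a shape multiset -/
def pbcM (G : Multiset (ℕ × ℕ × ℕ)) : ℕ := (G.map pbc).sum
/-- `P_CA` of a shape multiset -/
def pcaM (G : Multiset (ℕ × ℕ × ℕ)) : ℕ := (G.map pca).sum
/-- `UB_B(t) = Σ a c · min(t, b) + t · (M − P_CA)` -/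
def ubBM (M : ℕ) (G : Multiset (ℕ × ℕ × ℕ)) (t : ℕ) : ℕ :=
  (G.map fun x => x.1 * x.2.2 * min t x.2.1).sum + t * (M - pcaM G)
/-- `L_B(t) = Σ_{b < t} b · min(a, c)` -/
def lBM (G : Multiset (ℕ × ℕ × ℕ)) (t : ℕ) : ℕ :=
  (G.map fun x => if x.2.1 < t then x.2.1 * min x.1 x.2.2 else 0).sum

/-- rule U11-G, form B, on a shape multiset (verbatim transcription of `U11GFormB`) -/
abbrev U11GFormBM (M : ℕ) (G : Multiset (ℕ × ℕ × ℕ)) : Prop :=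
  ∀ t : ℕ, 2 ≤ t → t ≤ pabM G → t ≤ pbcM G → t ≤ lBM G t →
    (t = 2 → 2 * (pabM G + pbcM G) ≤ ubBM M G 2 + 4) ∧
    (3 ≤ t → t * (pabM G + pbcM G) + 1 ≤ ubBM M G t + 2 * t ^ 2)

/-- rule U11-P, form B, on a shape multiset (verbatim transcription of `U11PFormB`) -/
abbrev U11PFormBM (M : ℕ) (G : Multiset (ℕ × ℕ × ℕ)) : Prop :=
  ∀ t : ℕ, 1 ≤ t → t ≤ pabM G → t ≤ pbcM G → t * min M (pabM G + pbcM G - t) ≤ ubBM M G t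

/-- letter rotation `(a, b, c) ↦ (c, a, b)` (form A) -/
def rotA (x : ℕ × ℕ × ℕ) : ℕ × ℕ × ℕ := (x.2.2, x.1, x.2.1)
/-- letter rotation `(a, b, c) ↦ (b, c, a)` (form C) -/
def rotC (x : ℕ × ℕ × ℕ) : ℕ × ℕ × ℕ := (x.2.1, x.2.2, x.1)

/-- rule U11-G, all three letter forms, on a shape multiset -/
abbrev U11GM (M : ℕ) (G : Multiset (ℕ × ℕ × ℕ)) : Prop :=
  U11GFormBM M G ∧ U11GFormBM M (G.map rotA) ∧ U11GFormBM M (G.map rotC)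
/-- rule U11-P, all three letter forms, on a shape multiset -/
abbrev U11PM (M : ℕ) (G : Multiset (ℕ × ℕ × ℕ)) : Prop :=
  U11PFormBM M G ∧ U11PFormBM M (G.map rotA) ∧ U11PFormBM M (G.map rotC)

/-- vP admissibility of a shape multiset: `vM` (`AdmM`) + U11-G + U11-P at prime orders -/
def AdmVPM (M : ℕ) (G : Multiset (ℕ × ℕ × ℕ)) : Prop := AdmM M G ∧ U11GM M G ∧ (M.Prime → U11PM M G)

/-- Boolean test of U11-G on a list of shapes (kernel-evaluable; `false` = the node is killed by U11-G) -/
def u11GB (M : ℕ) (L : List (ℕ × ℕ × ℕ)) : Bool :=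
  decide (U11GFormBM M (L : Multiset (ℕ × ℕ × ℕ))) && decide (U11GFormBM M (((L : Multiset (ℕ × ℕ × ℕ))).map rotA)) &&
    decide (U11GFormBM M (((L : Multiset (ℕ × ℕ × ℕ))).map rotC))
/-- Boolean test of U11-P on a list of shapes -/
def u11PB (M : ℕ) (L : List (ℕ × ℕ × ℕ)) : Bool :=
  decide (U11PFormBM M (L : Multiset (ℕ × ℕ × ℕ))) && decide (U11PFormBM M (((L : Multiset (ℕ × ℕ × ℕ))).map rotA)) &&
    decide (U11PFormBM M (((L : Multiset (ℕ × ℕ × ℕ))).map rotC))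

/-- the Boolean U11-G test agrees with `U11GM` on the list read as a multiset -/
theorem u11GB_iff (M : ℕ) (L : List (ℕ × ℕ × ℕ)) : u11GB M L = true ↔ U11GM M (L : Multiset (ℕ × ℕ × ℕ)) := by
  unfold u11GB U11GM; simp only [Bool.and_eq_true, decide_eq_true_iff, and_assoc]
/-- the Boolean U11-P test agrees with `U11PM` on the list read as a multiset -/
theorem u11PB_iff (M : ℕ) (L : List (ℕ × ℕ × ℕ)) : u11PB M L = true ↔ U11PM M (L : Multiset (ℕ × ℕ × ℕ)) := by
  unfold u11PB U11PM; simp only [Bool.and_eq_true, decide_eq_true_iff, and_assoc]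

/-- sanity (kernel evaluation): the order-338 witness family `(7,5,5)+(6,6,6)³` passes U11-G; an over-packed toy family fails it -/
example : u11GB 338 [(7,5,5), (6,6,6), (6,6,6), (6,6,6)] = true := by decide +kernel
example : u11GB 40 [(6,6,1), (1,6,6)] = false := by decide +kernel

/-! ### Bridges from the `Fin N`-indexed tree rules -/

section family

variable {N : ℕ} (a b c : Fin N → ℕ)

/-- `pabM` of the shape multiset of a family is its `pAB` -/
theorem pabM_GM : pabM (GM a b c) = pAB a b c := by unfold pabM pAB; rw [sum_GM]; rfl
/-- `pbcM` of the shape multiset of a family is its `pBC` -/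
theorem pbcM_GM : pbcM (GM a b c) = pBC a b c := by unfold pbcM pBC; rw [sum_GM]; rfl
/-- `pcaM` of the shape multiset of a family is its `pCA` -/
theorem pcaM_GM : pcaM (GM a b c) = pCA a b c := by unfold pcaM pCA; rw [sum_GM]; rfl
/-- `ubBM` of the shape multiset of a family is its `ubB` -/
theorem ubBM_GM (M t : ℕ) : ubBM M (GM a b c) t = ubB M a b c t := by
  unfold ubBM ubB; rw [sum_GM, pcaM_GM]; rfl
/-- `lBM` of the shape multiset of a family is its `lB` -/
theorem lBM_GM (t : ℕ) : lBM (GM a b c) t = lB a b c t := by unfold lBM lB; rw [sum_GM]; rfl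

/-- rotating every shape by `rotA` is the shape multiset of the letter-rotated family `(c, a, b)` -/
theorem GM_map_rotA : (GM a b c).map rotA = GM c a b := by unfold GM; rw [Multiset.map_map]; rfl
/-- rotating every shape by `rotC` is the shape multiset of the letter-rotated family `(b, c, a)` -/
theorem GM_map_rotC : (GM a b c).map rotC = GM b c a := by unfold GM; rw [Multiset.map_map]; rfl

/-- exact bridge: U11-G form B on the shape multiset of a family is U11-G form B on the family -/
theorem u11GFormBM_GM (M : ℕ) : U11GFormBM M (GM a b c) ↔ U11GFormB M a b c := by
  unfold U11GFormB; simp only [U11GFormBM, pabM_GM, pbcM_GM, ubBM_GM, lBM_GM]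
/-- exact bridge: U11-P form B on the shape multiset of a family is U11-P form B on the family -/
theorem u11PFormBM_GM (M : ℕ) : U11PFormBM M (GM a b c) ↔ U11PFormB M a b c := by
  unfold U11PFormB; simp only [U11PFormBM, pabM_GM, pbcM_GM, ubBM_GM]

/-- exact bridge: U11-G (three letter forms) on the shape multiset of a family is `U11G` on the family -/
theorem u11GM_GM (M : ℕ) : U11GM M (GM a b c) ↔ U11G M a b c := by
  unfold U11G; simp only [U11GM, GM_map_rotA, GM_map_rotC, u11GFormBM_GM]
/-- exact bridge: U11-P (three letter forms) on the shape multiset of a family is `U11P` on the family -/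
theorem u11PM_GM (M : ℕ) : U11PM M (GM a b c) ↔ U11P M a b c := by
  unfold U11P; simp only [U11PM, GM_map_rotA, GM_map_rotC, u11PFormBM_GM]

/-- the bridge: a vP-admissible family has a vP-admissible shape multiset -/
theorem admVPM_GM {M : ℕ} (hN : 2 ≤ N) (h : SieveAdmissibleVP M a b c) : AdmVPM M (GM a b c) :=
  ⟨admM_GM a b c hN h.1, (u11GM_GM a b c M).mpr h.2.1, fun hp => (u11PM_GM a b c M).mpr (h.2.2 hp)⟩

/-! ### Heredity: every realised sub-multiset of a vP-admissible family passes U11-G / U11-P -/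

/-- the sub-family picked by an injective choice of indices realises the list -/
theorem GM_comp_emb {L : List (ℕ × ℕ × ℕ)} (φ : Fin L.length ↪ Fin N) (hφ : ∀ r, shp a b c (φ r) = L.get r) :
    GM (a ∘ φ) (b ∘ φ) (c ∘ φ) = (L : Multiset (ℕ × ℕ × ℕ)) := by
  have hs : shp (a ∘ φ) (b ∘ φ) (c ∘ φ) = L.get := by funext r; exact hφ r
  unfold GM; rw [hs, Fin.univ_val_map, List.ofFn_get]

/-- packing sums of a `vM`-admissible family -/
theorem packing_of_sieveAdmissible {M : ℕ} (hS : SieveAdmissible M a b c) :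
    pAB a b c ≤ M ∧ pBC a b c ≤ M ∧ pCA a b c ≤ M := by
  unfold SieveAdmissible at hS; dsimp only at hS
  obtain ⟨-, -, h2, -⟩ := hS
  exact h2

/-- heredity: every realised sub-multiset of the shapes of a `vM`-admissible family satisfying `U11G` satisfies `U11GM` -/
theorem u11GM_of_le {M : ℕ} (hS : SieveAdmissible M a b c) (hG : U11G M a b c) {L : List (ℕ × ℕ × ℕ)}
    (hL : (L : Multiset (ℕ × ℕ × ℕ)) ≤ GM a b c) : U11GM M (L : Multiset (ℕ × ℕ × ℕ)) := by
  obtain ⟨φ, -, hφ⟩ := exists_emb_of_le (shp a b c) L Finset.univ hL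
  obtain ⟨hAB, hBC, hCA⟩ := packing_of_sieveAdmissible a b c hS
  rw [← GM_comp_emb a b c φ hφ]
  exact (u11GM_GM _ _ _ M).mpr (VPRules.u11G_comp φ hAB hBC hCA hG)

/-- heredity: every realised sub-multiset of the shapes of a `vM`-admissible family satisfying `U11P` satisfies `U11PM` -/
theorem u11PM_of_le {M : ℕ} (hS : SieveAdmissible M a b c) (hP : U11P M a b c) {L : List (ℕ × ℕ × ℕ)}
    (hL : (L : Multiset (ℕ × ℕ × ℕ)) ≤ GM a b c) : U11PM M (L : Multiset (ℕ × ℕ × ℕ)) := by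
  obtain ⟨φ, -, hφ⟩ := exists_emb_of_le (shp a b c) L Finset.univ hL
  obtain ⟨hAB, hBC, hCA⟩ := packing_of_sieveAdmissible a b c hS
  rw [← GM_comp_emb a b c φ hφ]
  exact (u11PM_GM _ _ _ M).mpr (VPRules.u11P_comp φ hAB hBC hCA hP)

/-- node kill, as the checker uses it: if some sub-list of the family's shapes fails the Boolean U11-G test (or, at a prime order, the
U11-P test), the family is not vP-admissible -/
theorem not_admissibleVP_of_kill {M : ℕ} (hN : 2 ≤ N) {L : List (ℕ × ℕ × ℕ)} (hL : (L : Multiset (ℕ × ℕ × ℕ)) ≤ GM a b c)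
    (hk : u11GB M L = false ∨ (M.Prime ∧ u11PB M L = false)) : ¬ SieveAdmissibleVP M a b c := by
  intro h
  have _ := hN
  rcases hk with hk | ⟨hp, hk⟩
  · have := (u11GB_iff M L).mpr (u11GM_of_le a b c h.1 h.2.1 hL)
    rw [hk] at this; exact Bool.false_ne_true this
  · have := (u11PB_iff M L).mpr (u11PM_of_le a b c h.1 (h.2.2 hp) hL)
    rw [hk] at this; exact Bool.false_ne_true this

end family

end Summit.MatrixMultiplication.MatrixMultiplication.Theorems.ShapeCert
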